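import Summits.QuantumFields.YangMills.Theorems.LuscherReductionUpperTraceDoorDefs
import Summits.QuantumFields.YangMills.Theorems.LuscherReductionUpperTraceDoorBasics
import HarnessLib

/-!
# Crux RED `RunningReduction` (stmt-QuantumFields-19978), child `TwistedTraceScaling` (stmt-QuantumFields-20203): the UPPER-HALF TT DOOR —
# CERTIFICATE (W1): `TwistedTraceScaling ∧ OneSiteTail ⟹ FemtoWeyl`, and the upper half of the coarse level law uniformly over finitely many levels

Support module of the `FemtoTransferGap` group (fleet service by seat ym-infvol-p2 g7; route `LuscherReduction`, owner ym-beyond-p1, femto rung R2b1).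
RE-HOMES VERBATIM the first half of §4 and the (W1) part of §5 of the planner's kernel-checked crux workfile
`Summits/QuantumFields/YangMills/Cruxes/RunningReduction/Lines/upper_trace_door.lean` rev 3 (commit efcd23ff80e7, sha16 fb9acfdf08f96b2f; seat
ym-cruxidea-19978-1 GEN 7–8; memo `…/Lines/upper_trace_door.md` rev 4 §3 item 4) in namespace `…Theorems.FemtoTransferGap.UTD` (credit: the planner's
proofs, character for character; the femto Weyl bound is the tree predicate `UTD.FemtoWeylAt s0` of `…UpperTraceDoorDefs`, quantified `∀ s0, 0 < s0 → …`
= the workfile's closed `UTD.FemtoWeyl` by `Iff.rfl`; the coarse two-sided level law `CoarseLevels` is SPELLED OUT = the conclusion text of the tree's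
`TraceDoor.coarseLevels_of_twistedTraceScaling`, `Theorems/LuscherReductionTraceDoorCorollary.lean`).

PURPOSE of the (W) certificates (memo §3 item 4): the one-sided restatement `UpperTraceLaw` of the XL child is NOT stronger than what the children already
give — `TwistedTraceScaling ∧ OneSiteTail ⟹ FemtoWeyl` (this file) and `CoarseLevels ∧ FemtoWeyl ⟹ UpperTraceLaw` (`…UpperTraceDoorOfCoarseLevels`), and
the landed trace inversion INV (`TraceDoor.coarseLevels_of_twistedTraceScaling`) then give `TwistedTraceScaling ⟹ UpperTraceLaw` unconditionally.

* §1 `coarseUpper_uniform` — the UPPER half of `CoarseLevels`, uniformly over the levels `j ≤ J` (finite intersection of eventual statements).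
* §2 ★ (W1) `femtoWeyl_of_twistedTraceScaling : TwistedTraceScaling → OneSiteTail → ∀ s0, 0 < s0 → UTD.FemtoWeylAt s0`: at femto-time `s₀` the one-site
  heat trace is `≤ (K+1)μ₀^T` (`OneSiteTail`) and `≥ μ₀^{2T}` at `2T`, so the one-site dyadic ratio is `≥ 1/(K+1)²`; TTS with `ε = 1/(2(K+1)²)` transfers
  half of it to the full torus, and `physTrace(2T) ≤ λ₀^T·physTrace(T)` turns `r_L(T) ≥ c` into `physTrace(T) ≤ λ₀^T/c`;
  `femtoWeyl_of_twistedTraceScaling'` (child `OneSiteTail` = stmt-QuantumFields-20204 CLOSED, `OST.oneSiteTail_proof`).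

HONEST FRAMING: implications among OPEN statements on the femto rung R2b1 (`FemtoGapOfRecord`); `TwistedTraceScaling` is XL and ASSUMED; nothing here
bears on infinite volume, the continuum limit in large volume, or the Clay mass gap.
References: M. Lüscher, NPB 219 (1983) 233 [cite: Luscher1983, §3]; W. Feller, vol. II, XIII.1 [cite: Feller1971, XIII.1 Thm 2a].
-/

set_option autoImplicit false

noncomputable section

open MeasureTheory Filter Topology Real
open Literature.MathematicalPhysics.QuantumFieldTheory hiding SU2
open Literature.MathematicalPhysics.QuantumLattice
open Literature.Analysis.OperatorTheory.YMMatrixModel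
open scoped BigOperators

namespace Summit.QuantumFields.YangMills.Theorems.FemtoTransferGap.UTD

open Summit.QuantumFields.YangMills.Theorems.FemtoTransferGap
open Summit.QuantumFields.YangMills.Theorems.FemtoTransferGap.TT (physTrace)
open Summit.QuantumFields.YangMills.Theorems.FemtoTransferGap.TraceDoor
open Summit.QuantumFields.YangMills.Theorems.FemtoTransferGap.KTRCalibration (levelValue_antitone)
open Summit.QuantumFields.YangMills.Theses.LuscherReduction (RunningReduction TwistedTraceScaling DressedRitz TraceFormula OneSiteTail)

/-! ## §1 The upper half of the coarse level law, uniformly over finitely many levels (workfile §4, VERBATIM) -/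

/-- The UPPER half of `CoarseLevels` (spelled out), uniformly over the levels `j ≤ J` (finite intersection of eventual statements; credit
ym-cruxidea-19978-1). [cite: Luscher1983, §1] -/
theorem coarseUpper_uniform
    (hCL : ∀ k : ℕ, ∀ η : ℝ, 0 < η → ∃ lam0 : ℝ, 0 < lam0 ∧ ∀ lam : ℝ, 0 < lam → lam ≤ lam0 →
      ∃ L0 : ℕ, ∀ (L : ℕ) [NeZero L], L0 ≤ L → ∀ β : ℝ, InFemtoWindow lam β L →
        Real.exp (-((levelGap k + η) * luscherLambda β L) / L) * levelValue su2Rep L β 0 ≤ levelValue su2Rep L β k ∧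
          levelValue su2Rep L β k ≤ Real.exp (-((levelGap k - η) * luscherLambda β L) / L) * levelValue su2Rep L β 0)
    {η : ℝ} (hη : 0 < η) : ∀ J : ℕ, ∃ lam0 : ℝ, 0 < lam0 ∧ ∀ lam : ℝ, 0 < lam → lam ≤ lam0 →
    ∃ L0 : ℕ, ∀ (L : ℕ) [NeZero L], L0 ≤ L → ∀ β : ℝ, InFemtoWindow lam β L →
      ∀ j : ℕ, j ≤ J → levelValue su2Rep L β j ≤ Real.exp (-((levelGap j - η) * luscherLambda β L) / L) * levelValue su2Rep L β 0 := by
  intro J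
  induction J with
  | zero =>
    obtain ⟨lam0, hlam0, h⟩ := hCL 0 η hη
    refine ⟨lam0, hlam0, fun lam hlam hle => ?_⟩
    obtain ⟨L0, hL0⟩ := h lam hlam hle
    refine ⟨L0, fun L _ hL β hW j hj => ?_⟩
    obtain rfl : j = 0 := Nat.le_zero.mp hj
    exact (hL0 L hL β hW).2
  | succ J ih =>
    obtain ⟨lamA, hlamA, hA⟩ := ih
    obtain ⟨lamB, hlamB, hB⟩ := hCL (J + 1) η hη
    refine ⟨min lamA lamB, lt_min hlamA hlamB, fun lam hlam hle => ?_⟩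
    obtain ⟨LA, hLA⟩ := hA lam hlam (hle.trans (min_le_left _ _))
    obtain ⟨LB, hLB⟩ := hB lam hlam (hle.trans (min_le_right _ _))
    refine ⟨max LA LB, fun L _ hL β hW j hj => ?_⟩
    rcases hj.lt_or_eq with hlt | heq
    · exact hLA L ((le_max_left _ _).trans hL) β hW j (Nat.lt_succ_iff.mp hlt)
    · subst heq; exact (hLB L ((le_max_right _ _).trans hL) β hW).2

/-! ## §2 (W1) `TwistedTraceScaling ∧ OneSiteTail ⟹ FemtoWeyl` (workfile §4–§5, VERBATIM) -/

set_option maxHeartbeats 1600000 in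
/-- ★ (W1) `TwistedTraceScaling ∧ OneSiteTail ⟹ FemtoWeyl` (workfile §4, proof VERBATIM; credit ym-cruxidea-19978-1): at femto-time `s₀` the one-site heat trace is `≤ (K+1)μ₀^T` (OneSiteTail) and `≥ μ₀^{2T}` at `2T`,
so the one-site dyadic ratio is `≥ 1/(K+1)²`; TTS with `ε = 1/(2(K+1)²)` transfers half of it to the full torus, and `physTrace(2T) ≤ λ₀^T·physTrace(T)`
turns `r_L(T) ≥ c` into `physTrace(T) ≤ λ₀^T/c`. [cite: Luscher1983, §3] [cite: Feller1971, XIII.1 Thm 2a] -/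
theorem femtoWeyl_of_twistedTraceScaling (hTTS : TwistedTraceScaling) (hOST : OneSiteTail) :
    ∀ s0 : ℝ, 0 < s0 → UTD.FemtoWeylAt s0 := by
  intro s0 hs0
  unfold UTD.FemtoWeylAt
  obtain ⟨K, B0, hK⟩ := hOST s0 hs0 1 one_pos
  set Bs : ℝ := max B0 1 with hBsdef
  have hBs1 : 1 ≤ Bs := le_max_right _ _
  have hBspos : 0 < Bs := one_pos.trans_le hBs1
  have hKpos : 0 < (K : ℝ) + 1 := by positivity
  set c : ℝ := 1 / (2 * ((K : ℝ) + 1) ^ 2) with hcdef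
  have hc : 0 < c := by positivity
  obtain ⟨lamT, hlamT, hTT⟩ := hTTS s0 hs0 c hc
  have hq : 0 < min (s0 / 4) (min (1 / 8) (1 / (4 * Bs))) := lt_min (by positivity) (lt_min (by norm_num) (by positivity))
  refine ⟨1 / c, min lamT (min (s0 / 4) (min (1 / 8) (1 / (4 * Bs)))), lt_min hlamT hq, fun lam hlam hlamle => ?_⟩
  have hlamT' : lam ≤ lamT := hlamle.trans (min_le_left _ _)
  have hlams : lam ≤ s0 / 4 := hlamle.trans ((min_le_right _ _).trans (min_le_left _ _))
  have hlam8 : lam ≤ 1 / 8 := hlamle.trans ((min_le_right _ _).trans ((min_le_right _ _).trans (min_le_left _ _)))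
  have hlamB : lam ≤ 1 / (4 * Bs) := hlamle.trans ((min_le_right _ _).trans ((min_le_right _ _).trans (min_le_right _ _)))
  obtain ⟨L0, hL0⟩ := hTT lam hlam hlamT'
  refine ⟨L0, fun L _ hL β hW => ?_⟩
  have htts := hL0 L hL β hW
  have hBge : Bs ≤ oneSiteCoupling β L := oneSiteCoupling_ge_of_small hlam hW hBspos hlam8 hlamB
  obtain ⟨hβ, hlamle', hlam2⟩ := hW
  -- scales
  set l : ℝ := luscherLambda β L with hldef
  have hlpos : 0 < l := hlam.trans_le hlamle'
  have hLpos : (0 : ℝ) < L := Nat.cast_pos.mpr (NeZero.pos L)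
  have hL1 : (1 : ℝ) ≤ L := by exact_mod_cast NeZero.one_le
  set x : ℝ := l / L with hxdef
  have hxpos : 0 < x := div_pos hlpos hLpos
  have hxl : x ≤ l := div_le_self hlpos.le hL1
  have hx2 : x ≤ s0 / 2 := by linarith only [hxl, hlam2, hlams]
  set B : ℝ := oneSiteCoupling β L with hBdef
  have hB0' : B0 ≤ B := (le_max_left _ _).trans hBge
  have hB1 : 1 ≤ B := hBs1.trans hBge
  have hbl : bareLambda B = x := by rw [hBdef, hxdef, hldef]; exact bareLambda_oneSiteCoupling hlpos
  have hmu0 : 0 < levelValue su2Rep 1 B 0 := levelValue_zero_su2Rep_pos 1 B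
  have hl0 : 0 < levelValue su2Rep L β 0 := levelValue_zero_su2Rep_pos L β
  -- time
  set T : ℕ := femtoSteps s0 β L with hTdef
  obtain ⟨hτlo0, -⟩ := femtoSteps_mul_bounds (s := s0) (β := β) (L := L) hs0.le hlpos
  have hτlo : s0 ≤ (T : ℝ) * x := hτlo0
  have hT2r : (2 : ℝ) ≤ T := by
    have h1 : 2 * x ≤ (T : ℝ) * x := by linarith only [hx2, hτlo]
    exact le_of_mul_le_mul_right h1 hxpos
  have hT2 : 2 ≤ T := by exact_mod_cast hT2r
  have h2T2 : 2 ≤ 2 * T := by omega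
  -- level currency on both lattices at `T` and `2T`
  set y : ℕ → ℝ := xval 1 B with hydef
  set z : ℕ → ℝ := xval L β with hzdef
  have hy0 : ∀ i, 0 ≤ y i := fun i => xval_nonneg hB1 i
  have hy1 : ∀ i, y i ≤ 1 := fun i => xval_le_one hB1 i
  have hz0 : ∀ j, 0 ≤ z j := fun j => xval_nonneg hβ j
  have hz1 : ∀ j, z j ≤ 1 := fun j => xval_le_one hβ j
  have hHS := hasSum_xval_pow (L := L) (β := β) hβ hT2
  have hHS2 := hasSum_xval_pow (L := L) (β := β) hβ h2T2
  have hHS1 := hasSum_xval_pow (L := 1) (β := B) hB1 hT2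
  have hHS12 := hasSum_xval_pow (L := 1) (β := B) hB1 h2T2
  set P1 : ℝ := physTrace L β T with hP1def
  set P2 : ℝ := physTrace L β (2 * T) with hP2def
  set Q1 : ℝ := physTrace 1 B T with hQ1def
  set Q2 : ℝ := physTrace 1 B (2 * T) with hQ2def
  have hl0T : 0 < levelValue su2Rep L β 0 ^ T := pow_pos hl0 T
  have hmu0T : 0 < levelValue su2Rep 1 B 0 ^ T := pow_pos hmu0 T
  -- (a) `P1 ≥ λ₀^T`
  have hz0one : z 0 = 1 := by show levelValue su2Rep L β 0 / levelValue su2Rep L β 0 = 1; exact div_self hl0.ne'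
  have hy0one : y 0 = 1 := by show levelValue su2Rep 1 B 0 / levelValue su2Rep 1 B 0 = 1; exact div_self hmu0.ne'
  have hA1 : 1 ≤ P1 / levelValue su2Rep L β 0 ^ T := by
    have := le_hasSum hHS 0 (fun j _ => pow_nonneg (hz0 j) T)
    have e : xval L β 0 ^ T = 1 := by show z 0 ^ T = 1; rw [hz0one, one_pow]
    rwa [e] at this
  have hP1pos : 0 < P1 := by
    have : levelValue su2Rep L β 0 ^ T ≤ P1 := by rwa [le_div_iff₀ hl0T, one_mul] at hA1
    exact hl0T.trans_le this
  -- (b) `P2 ≤ λ₀^T · P1`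
  have hP2le : P2 ≤ levelValue su2Rep L β 0 ^ T * P1 := by
    have hterm : ∀ j, z j ^ (2 * T) ≤ z j ^ T := fun j => pow_le_pow_of_le_one (hz0 j) (hz1 j) (by omega)
    have h1 : ∑' j, z j ^ (2 * T) ≤ ∑' j, z j ^ T := hHS2.summable.tsum_le_tsum hterm hHS.summable
    have h2 : P2 / levelValue su2Rep L β 0 ^ (2 * T) ≤ P1 / levelValue su2Rep L β 0 ^ T := by
      have e2 : ∑' j, z j ^ (2 * T) = P2 / levelValue su2Rep L β 0 ^ (2 * T) := hHS2.tsum_eq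
      have e1 : ∑' j, z j ^ T = P1 / levelValue su2Rep L β 0 ^ T := hHS.tsum_eq
      rw [← e1, ← e2]; exact h1
    have e3 : levelValue su2Rep L β 0 ^ (2 * T) = levelValue su2Rep L β 0 ^ T * levelValue su2Rep L β 0 ^ T := by rw [two_mul, pow_add]
    rw [e3, div_le_iff₀ (mul_pos hl0T hl0T)] at h2
    calc P2 ≤ P1 / levelValue su2Rep L β 0 ^ T * (levelValue su2Rep L β 0 ^ T * levelValue su2Rep L β 0 ^ T) := h2
      _ = levelValue su2Rep L β 0 ^ T * P1 := by field_simp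
  -- (c) `Q1 ≤ (K+1) μ₀^T`
  have hsum1 : Summable (fun i => y i ^ T) := hHS1.summable
  have hadm : s0 ≤ 2 * ((T : ℝ) * bareLambda B) := by rw [hbl]; linarith only [hτlo, hs0]
  obtain ⟨-, htail1⟩ := hK B hB0' T hadm
  have htail1' : ∑' i, y (i + K) ^ T ≤ 1 := htail1
  have hQ1le : Q1 ≤ ((K : ℝ) + 1) * levelValue su2Rep 1 B 0 ^ T := by
    have h1 : ∑' i, y i ^ T ≤ (K : ℝ) + 1 := by
      rw [← hsum1.sum_add_tsum_nat_add K]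
      have hhead : ∑ i ∈ Finset.range K, y i ^ T ≤ K := by
        calc ∑ i ∈ Finset.range K, y i ^ T ≤ ∑ i ∈ Finset.range K, (1 : ℝ) := Finset.sum_le_sum fun i _ => pow_le_one₀ (hy0 i) (hy1 i)
          _ = K := by simp
      linarith only [hhead, htail1']
    have e1 : ∑' i, y i ^ T = Q1 / levelValue su2Rep 1 B 0 ^ T := hHS1.tsum_eq
    rw [e1, div_le_iff₀ hmu0T] at h1
    exact h1
  have hQ1pos : 0 < Q1 := by
    have h := le_hasSum hHS1 0 (fun j _ => pow_nonneg (hy0 j) T)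
    have e : xval 1 B 0 ^ T = 1 := by show y 0 ^ T = 1; rw [hy0one, one_pow]
    rw [e] at h
    have e1 : Q1 / levelValue su2Rep 1 B 0 ^ T = ∑' i, xval 1 B i ^ T := hHS1.tsum_eq.symm
    have : levelValue su2Rep 1 B 0 ^ T ≤ Q1 := by
      have h' : (1 : ℝ) ≤ Q1 / levelValue su2Rep 1 B 0 ^ T := h
      rwa [le_div_iff₀ hmu0T, one_mul] at h'
    exact hmu0T.trans_le this
  -- (d) `Q2 ≥ μ₀^{2T}`
  have hQ2ge : levelValue su2Rep 1 B 0 ^ (2 * T) ≤ Q2 := by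
    have h := le_hasSum hHS12 0 (fun j _ => pow_nonneg (hy0 j) (2 * T))
    have e : xval 1 B 0 ^ (2 * T) = 1 := by show y 0 ^ (2 * T) = 1; rw [hy0one, one_pow]
    rw [e] at h
    have h' : (1 : ℝ) ≤ Q2 / levelValue su2Rep 1 B 0 ^ (2 * T) := h
    rwa [le_div_iff₀ (pow_pos hmu0 _), one_mul] at h'
  -- (e) the one-site dyadic ratio is `≥ 2c`
  have hr1 : 2 * c ≤ Q2 / Q1 ^ 2 := by
    rw [le_div_iff₀ (pow_pos hQ1pos 2)]
    have h1 : Q1 ^ 2 ≤ (((K : ℝ) + 1) * levelValue su2Rep 1 B 0 ^ T) ^ 2 := pow_le_pow_left₀ hQ1pos.le hQ1le 2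
    have e : (((K : ℝ) + 1) * levelValue su2Rep 1 B 0 ^ T) ^ 2 = ((K : ℝ) + 1) ^ 2 * levelValue su2Rep 1 B 0 ^ (2 * T) := by
      rw [mul_pow, ← pow_mul, mul_comm T 2]
    have e2 : 2 * c * (((K : ℝ) + 1) ^ 2 * levelValue su2Rep 1 B 0 ^ (2 * T)) = levelValue su2Rep 1 B 0 ^ (2 * T) := by
      rw [hcdef]; field_simp
    calc 2 * c * Q1 ^ 2 ≤ 2 * c * (((K : ℝ) + 1) ^ 2 * levelValue su2Rep 1 B 0 ^ (2 * T)) := by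
          rw [← e]; exact mul_le_mul_of_nonneg_left h1 (by positivity)
      _ = levelValue su2Rep 1 B 0 ^ (2 * T) := e2
      _ ≤ Q2 := hQ2ge
  -- (f) TTS transfers: `P2/P1² ≥ c`
  have hrL : c ≤ P2 / P1 ^ 2 := by
    have h := (abs_sub_le_iff.1 htts).2
    have h' : Q2 / Q1 ^ 2 - P2 / P1 ^ 2 ≤ c := h
    linarith only [h', hr1]
  -- (g) conclusion `P1 ≤ λ₀^T / c`
  have h1 : c * P1 ^ 2 ≤ levelValue su2Rep L β 0 ^ T * P1 := by
    rw [le_div_iff₀ (pow_pos hP1pos 2)] at hrL; exact hrL.trans hP2le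
  have h2 : c * P1 ≤ levelValue su2Rep L β 0 ^ T := by
    have h1' : c * P1 * P1 ≤ levelValue su2Rep L β 0 ^ T * P1 := by rw [mul_assoc, ← pow_two]; exact h1
    exact le_of_mul_le_mul_right h1' hP1pos
  show P1 ≤ 1 / c * levelValue su2Rep L β 0 ^ T
  rw [one_div, ← div_eq_inv_mul, le_div_iff₀ hc, mul_comm]
  exact h2

/-- (W1) with the CLOSED child `OneSiteTail` (stmt-QuantumFields-20204, `OST.oneSiteTail_proof`) plugged in: `TwistedTraceScaling ⟹ FemtoWeyl` unconditionally
(workfile §5). [cite: Luscher1983, §3] -/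
theorem femtoWeyl_of_twistedTraceScaling' (hTTS : TwistedTraceScaling) : ∀ s0 : ℝ, 0 < s0 → UTD.FemtoWeylAt s0 :=
  femtoWeyl_of_twistedTraceScaling hTTS OST.oneSiteTail_proof

end Summit.QuantumFields.YangMills.Theorems.FemtoTransferGap.UTD

end
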